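import Literature.Topology.FourManifolds.ComplexProjectiveSpaceCohomologyRing
import Literature.AlgebraicTopology.CharacteristicClasses.ProjectivizationCharts
import HarnessLib

/-!
# The integral cohomology of `ℙ(V)` for an abstract finite-dimensional `V`: vanishing, `ℤ`-lines, cup powers

Topic `Literature/AlgebraicTopology/CharacteristicClasses`. D. Husemoller, *Fibre Bundles*, 3rd
ed. (1994), Ch. 17 §2 (2.3): "`H*(ℂPⁿ⁻¹; ℤ)` is the free module on `1, a, …, aⁿ⁻¹`", i.e.
(A. Hatcher, *Algebraic Topology* (2002), Thm. 3.12 / 3.19) `H*(ℂPᵐ; ℤ) = ℤ[x]/(xᵐ⁺¹)`.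

The tree proves this for its model `ComplexProjectiveSpace m = ℙ(ℂᵐ⁺¹)`
(`Topology/FourManifolds/ComplexProjectiveSpaceCohomologyRing`: `isZero_singularCohomology_int`,
`nonempty_singularCohomology_equiv_int`, `span_cupPowL_eq_top`). The fibres of a projective bundle
are the projective spaces `ℙ ℂ V` of ABSTRACT finite-dimensional normed spaces `V`; this file
transports the three statements along the homeomorphism `ℙ ℂ V ≃ₜ ℂPᵐ` (`finrank V = m + 1`)
induced by a linear isomorphism `V ≃L ℂᵐ⁺¹` (`homeomorphComplexProjectiveSpace`):

* `isZero_singularCohomology_projectivization` — `Hⁱ(ℙ V; ℤ) = 0` unless `i` is even and `≤ 2m`;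
* `nonempty_singularCohomology_projectivization_equiv_int` — `Hⁱ(ℙ V; ℤ) ≅ ℤ` for `i ≥ 1` even, `≤ 2m`
  (and two generators of a `ℤ`-line agree up to sign, `eq_or_eq_neg_of_span_eq_top`);
* `span_cupPowL_projectivization_eq_top` — **if `x` generates `H²(ℙ V; ℤ)` then `xᵏ` generates
  `H²ᵏ(ℙ V; ℤ)` for `k ≤ m`**.

Everything is proved; no named facts.

## References

* [HusemollerFibreBundles1994] D. Husemoller, *Fibre Bundles*, 3rd ed. (1994), Ch. 17 §2 (2.3).
* [HatcherAT2002] A. Hatcher, *Algebraic Topology*, CUP 2002, Thm. 3.12, Thm. 3.19.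
-/

noncomputable section

open CategoryTheory Limits Module Function
open Literature.AlgebraicTopology.SingularHomology Literature.Topology.FourManifolds
open scoped LinearAlgebra.Projectivization

namespace Literature.AlgebraicTopology.CharacteristicClasses

/-! ### `ℙ ℂ V ≃ₜ ℂPᵐ` -/

/-- **`ℙ(ℂᵐ⁺¹) ≃ₜ ℂPᵐ`** by the identity: the tree's `ComplexProjectiveSpace m` is a type synonym of
`ℙ ℂ (Fin (m + 1) → ℂ)` and both carry the quotient topology of `ℂᵐ⁺¹ ∖ 0`. [folklore] -/
def finProjectivizationHomeomorph (m : ℕ) : ℙ ℂ (Fin (m + 1) → ℂ) ≃ₜ ComplexProjectiveSpace m where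
  toEquiv := Equiv.refl _
  continuous_toFun := continuous_id
  continuous_invFun := continuous_id

variable {V : Type} [NormedAddCommGroup V] [NormedSpace ℂ V] [FiniteDimensional ℂ V]

/-- **`ℙ ℂ V ≃ₜ ℂPᵐ` for `dim V = m + 1`**, through a linear isomorphism `V ≃L ℂᵐ⁺¹`
(Husemoller Ch. 17 §2: the fibre `FPⁿ⁻¹` of `P(ξ)`). [cite: HusemollerFibreBundles1994, Ch. 17 §2 (2.3)] -/
def homeomorphComplexProjectiveSpace {m : ℕ} (hV : finrank ℂ V = m + 1) : ℙ ℂ V ≃ₜ ComplexProjectiveSpace m :=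
  (homeomorphOfContinuousLinearEquiv
    (ContinuousLinearEquiv.ofFinrankEq (by rw [hV, finrank_fin_fun]) : V ≃L[ℂ] (Fin (m + 1) → ℂ))).trans
    (finProjectivizationHomeomorph m)

/-! ### Transport of the cohomology -/

/-- **`Hⁱ(ℙ V; ℤ) = 0` for `i` odd or `i > 2m`** (`dim V = m + 1`). [cite: HatcherAT2002, Thm. 3.12] -/
theorem isZero_singularCohomology_projectivization {m : ℕ} (hV : finrank ℂ V = m + 1) {i : ℕ}
    (hi : ¬(Even i ∧ i ≤ 2 * m)) : IsZero (singularCohomology ℤ ℤ (ℙ ℂ V) i) :=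
  (ComplexProjectiveSpace.isZero_singularCohomology_int hi).of_iso
    (singularCohomology.mapIso ℤ ℤ (homeomorphComplexProjectiveSpace hV).symm i)

/-- **`Hⁱ(ℙ V; ℤ) ≅ ℤ` for `i ≥ 1` even, `i ≤ 2m`** (`dim V = m + 1`). [cite: HatcherAT2002, Thm. 3.12] -/
theorem nonempty_singularCohomology_projectivization_equiv_int {m : ℕ} (hV : finrank ℂ V = m + 1) {k : ℕ}
    (hk : Even (k + 1) ∧ k + 1 ≤ 2 * m) : Nonempty (singularCohomology ℤ ℤ (ℙ ℂ V) (k + 1) ≃ₗ[ℤ] ℤ) := by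
  obtain ⟨e⟩ := ComplexProjectiveSpace.nonempty_singularCohomology_equiv_int (n := m) hk
  exact ⟨(singularCohomology.mapIso ℤ ℤ (homeomorphComplexProjectiveSpace hV).symm (k + 1)).toLinearEquiv.trans e⟩

/-- **Two generators of a `ℤ`-line agree up to sign.** [folklore] -/
theorem eq_or_eq_neg_of_span_eq_top {M : Type*} [AddCommGroup M] [Module ℤ M] (e : M ≃ₗ[ℤ] ℤ) {g x : M}
    (hg : Submodule.span ℤ {g} = ⊤) (hx : Submodule.span ℤ {x} = ⊤) : g = x ∨ g = -x := by
  have hg' := (span_singleton_eq_top_iff_of_equiv e g).1 hg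
  have hx' := (span_singleton_eq_top_iff_of_equiv e x).1 hx
  have h1 : e (-x) = -e x := map_neg e x
  rcases hg' with h | h <;> rcases hx' with h' | h'
  · exact Or.inl (e.injective (h.trans h'.symm))
  · exact Or.inr (e.injective (by rw [h, h1, h']; norm_num))
  · exact Or.inr (e.injective (by rw [h, h1, h']))
  · exact Or.inl (e.injective (h.trans h'.symm))

/-- **The cohomology ring of `ℙ V`: if `x` generates `H²(ℙ V; ℤ)` then `xᵏ` generates `H²ᵏ(ℙ V; ℤ)`
for `k ≤ m`** (`dim V = m + 1`; Husemoller Ch. 17 §2 (2.3): `1, a, …, aᵐ` is a base; Hatcher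
Thm. 3.19), transported from the tree's `ComplexProjectiveSpace.span_cupPowL_eq_top`.
[cite: HusemollerFibreBundles1994, Ch. 17 §2 (2.3)] [cite: HatcherAT2002, Thm. 3.19] -/
theorem span_cupPowL_projectivization_eq_top {m : ℕ} (hV : finrank ℂ V = m + 1)
    (x : singularCohomology ℤ ℤ (ℙ ℂ V) 2) (hx : Submodule.span ℤ {x} = ⊤) {k : ℕ} (hk : k ≤ m) :
    Submodule.span ℤ {cupPowL x k} = ⊤ := by
  set h := homeomorphComplexProjectiveSpace hV with hh
  -- transport `x` to `ℂPᵐ` along `h⁻¹ : ℂPᵐ → ℙ V`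
  let e2 := (singularCohomology.mapIso ℤ ℤ h.symm 2).toLinearEquiv
  have hy : Submodule.span ℤ {singularCohomology.map ℤ ℤ (h.symm : C(ComplexProjectiveSpace m, ℙ ℂ V)) 2 x} = ⊤ :=
    span_singleton_eq_top_of_equiv e2 hx
  have hk' := ComplexProjectiveSpace.span_cupPowL_eq_top m _ hy hk
  rw [← map_cupPowL] at hk'
  -- and back along the inverse isomorphism in degree `2k`
  let ek := (singularCohomology.mapIso ℤ ℤ h.symm (2 * k)).toLinearEquiv
  have := span_singleton_eq_top_of_equiv ek.symm hk'
  rwa [show ek.symm (singularCohomology.map ℤ ℤ (h.symm : C(ComplexProjectiveSpace m, ℙ ℂ V)) (2 * k) (cupPowL x k)) =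
    cupPowL x k from ek.symm_apply_apply (cupPowL x k)] at this

end Literature.AlgebraicTopology.CharacteristicClasses
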